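import Mathlib
import HarnessLib
import Summits.HubbardSuperconductivity.HubbardSuperconductivity.Theorems.KLProgrammeKLRegimeEngineTwoLegStepSuccDoor
import Summits.HubbardSuperconductivity.HubbardSuperconductivity.Theorems.KLProgrammeKLRegimeSplitTwoLegSizesMSLowMixed

/-!
# K3 ENGINE child `KLRegimeEngineV16` (stmt-HubbardSuperconductivity-20236, skeleton v3-α 9747d23d14535406), stub (e) `stub_twoLeg_step`:
# the MULTI-SLOT conjunct `TwoLegSizesMSTQ … (n+1)` under the stub's binders, and the CORE-AGNOSTIC assembly door (sequel of `…EngineTwoLegStepSuccDoor`)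

Cell gate-hubbard-kl, seat hubbard-kl-r2d-p1 (g4); plan g15 START-HERE (KL STATUS 2026-08-27T08:41:42Z).  `…EngineTwoLegStepSuccDoor` takes conjunct (B)
`TwoLegSizesMSTQ … (n+1)` of the slot by name; here it is supplied from the MS-lane consumer theorems, and the assembly is stated with the CORE conjunct
`TwoLegCoreTD … (n+1)` BY NAME, so that every core closer of the two-leg lane (p1b's `…_of_tubeSizes_stub7`, `…_of_profileData_stub8`, the stub-6-keyed
twin of `…EngineTwoLegStepSuccDoorProfile`) plugs in with one application:

* `continuous_klLocalPart_stub` — the MS consumers' `hc₁`/`hc₀` (continuity of the local parts) from the stub's binders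
  (`frame_sizes_of_frameOK_explicit` at `c ≤ klEngC₃3 ≤ klCurveC3`, `U ≤ klEngU₀4 ≤ klCurveU0` + `PerturbedFermiCurve.contDiff_klLocalPart`);
* **`twoLegSizesMSTQ_succ_of_pieces_mixed_stub`** (`n + 1 ≤ nScales β`) — `TwoLegSizesMSTQ L M klEngGeo5 (klEngQ5 P R) R β U μ K (n+1)` under the stub's
  binders from k3c3-p1's `twoLegSizesMSTQ_succ_of_pieces_mixed` (…TwoLegSizesMSLowMixed: the mixed Jackson–Bernstein bound supplies the low-part totals,
  `Λⱼ := msLam R U d (n+1) j`): residuals = the admissible pieces `Kp` of the frame (free: `FrameOK`'s ∃Kp), the symbol decomposition `S` of the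
  local-part increment, its sizes `σ` (orders 0…5) and slot differences `ε` (orders 0…4), a cutoff-derivative bound `X` (orders ≤ 4), the two
  depth-graded fits; thresholds `/16` from the first file's §1, continuity discharged;
* **`twoLegSizesMSTQ_top_stub`** (scale `nScales β + 1`) — through `twoLegSizesMSTQ_top_of_frameOK` (one symbol `S`, sizes `σ l`, l ≤ 4);
* **`twoLegStepV16_succ_of_core_of_pieces_mixed_stub`**, **`twoLegStepV16_top_of_core_stub`** — the slot at `n + 1` / at the top scale from the core
  conjunct BY NAME, the MS data above and the two nested-leg rates (k3c4-p1's door).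

Proofs only (compositions of landed theorems); no definitions; nothing about the model is asserted.
References: BGM 2006 §2.4 (2.36), §3 [cite: BenfattoGiulianiMastropietro2006]; MS-SUPPLIER-SHEET (evidence #35 on stmt-HubbardSuperconductivity-19918).
-/

noncomputable section

namespace Summit.HubbardSuperconductivity.HubbardSuperconductivity.Theorems.EngineV8

set_option linter.dupNamespace false -- summit = problem name (single-conjunct summit), D-0017

open Real Finset Literature.MathematicalPhysics.QuantumLattice Literature.Probability.LatticeModels
open Literature.MathematicalPhysics.QuantumLattice.FermiRG Literature.MathematicalPhysics.QuantumLattice.BandSectorCounting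
open Summit.HubbardSuperconductivity.HubbardSuperconductivity.Theorems.KLProgrammeLegKernels
open Summit.HubbardSuperconductivity.HubbardSuperconductivity.Theorems.DispersionFlow
open Summit.HubbardSuperconductivity.HubbardSuperconductivity.Theorems.PerturbedFermiCurve
open Summit.HubbardSuperconductivity.HubbardSuperconductivity.Theorems.KLRegimeSplit

variable {L M : ℕ} [NeZero L] [NeZero M]

/-! ## §1 Continuity of the local parts under the stub's binders -/

/-- **Continuity of the local part at every scale under the stub's binders** (the MS consumers' `hc₁`/`hc₀`). -/
theorem continuous_klLocalPart_stub {P : SplitConsts} {R : RenConsts} (hR : R.WF2) {c : ℝ} (hc : 0 < c) (hc3 : c ≤ klEngC₃3 P R)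
    {U : ℝ} (hU : 0 < U) (hUle : U ≤ klEngU₀4 P R c) {β : ℝ} (hβ : klBetaMin ≤ β) (hβc : β ≤ Real.exp (c / U ^ 2)) {μ : ℝ}
    (hμ : μ ∈ klWindowC) {K : TrigPolyC4v} (hK : FrameOK R U (nScales β) μ K) (L M : ℕ) [NeZero L] [NeZero M] (k : ℕ) :
    Continuous (klLocalPart L M β U μ K k) := by
  have hR' : ∀ j, 0 ≤ R.Gfr j := hR.1.2.2
  have hcle : c ≤ klCurveC3 R := hc3.trans (klEngC₃3_le_klCurveC3 P hR')
  have hUle' : U ≤ klCurveU0 R := (le_klEngU₀3_of_le_klEngU₀4 hUle).trans (klEngU₀3_le_klCurveU0 P hR' c)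
  have ha' : (-4 : ℝ) < -1.1 := by norm_num
  have hab : (-1.1 : ℝ) ≤ -0.1 := by norm_num
  have hb : (-0.1 : ℝ) < 0 := by norm_num
  obtain ⟨hAf, -, hADt, -, ⟨hlo, hhi⟩, -, -⟩ := frame_sizes_of_frameOK_explicit hR' hc hcle hU hUle' hβ hβc hμ hK
  exact (PerturbedFermiCurve.contDiff_klLocalPart (bandBounds ha' hab hb) hAf hADt hlo hhi L M β U k (m := 4)).continuous

/-! ## §2 The multi-slot conjunct at scale `n + 1 ≤ nScales β` and at the top scale, under the stub's binders -/

/-- **(B) `TwoLegSizesMSTQ … (n+1)` UNDER THE STUB'S BINDERS** (`n + 1 ≤ nScales β`) from k3c3-p1's `twoLegSizesMSTQ_succ_of_pieces_mixed`: the caller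
supplies the admissible pieces `Kp` of the frame (`FrameOK`'s ∃Kp; `pieceSize` is its clause verbatim), the MS-SUPPLIER-SHEET data at scale `n + 1`
(symbol decomposition `S` of the local-part increment, sizes `σ`, slot differences `ε`, cutoff bound `X`) and the two depth-graded fits at
`Λⱼ := msLam R U d (n+1) j`; thresholds and continuity are discharged here. -/
theorem twoLegSizesMSTQ_succ_of_pieces_mixed_stub {P : SplitConsts} {R : RenConsts} {c : ℝ} (hR : R.WF2) (hc : 0 < c)
    (hc3 : c ≤ klEngC₃3 P R) {μ : ℝ} (hμ : μ ∈ klWindowC) {U : ℝ} (hU : 0 < U) (hUle : U ≤ klEngU₀4 P R c) {β : ℝ} (hβ : klBetaMin ≤ β)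
    (hβc : β ≤ Real.exp (c / U ^ 2)) {K : TrigPolyC4v} (hK : FrameOK R U (nScales β) μ K) {n : ℕ} (hn : n + 1 ≤ nScales β)
    {Kp : ℕ → TrigPolyC4v} (hKp : ∀ p : Fin 2 → ℝ, K.eval p = ∑ m ∈ range (nScales β + 1), (Kp m).eval p)
    (ha : ∀ m ≤ nScales β, ∀ j ≤ 4, ∀ q : Momentum, ‖iteratedFDeriv ℝ j (evalM (Kp m)) q‖ ≤ pieceSize R U m j)
    (d : ℕ)
    {S : ℕ → TrigPolyC4v}
    (hS : ∀ θ, klLocalPart L M β U μ K (n + 1) θ - klLocalPart L M β U μ K n θ =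
      (S (nScales β - (n + 1))).eval (klFermiPoint μ K θ))
    {σ : ℕ → ℕ → ℝ} (hσnn : ∀ k l, 0 ≤ σ k l)
    (hσ0 : ∀ k ≤ nScales β - (n + 1), ∀ q : Momentum, |evalM (S k) q| ≤ σ k 0)
    (hσ : ∀ k ≤ nScales β - (n + 1), ∀ l, 1 ≤ l → l ≤ 5 → ∀ q : Momentum, ‖iteratedFDeriv ℝ l (evalM (S k)) q‖ ≤ σ k l)
    {ε : ℕ → ℕ → ℝ} (hεnn : ∀ m l, 0 ≤ ε m l)
    (hε0 : ∀ m ∈ Ioc (n + 1) (nScales β), ∀ q : Momentum, |evalM (fsub (S (m - (n + 1))) (S (m - (n + 1) - 1))) q| ≤ ε m 0)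
    (hε : ∀ m ∈ Ioc (n + 1) (nScales β), ∀ l, 1 ≤ l → l ≤ 4 → ∀ q : Momentum,
      ‖iteratedFDeriv ℝ l (evalM (fsub (S (m - (n + 1))) (S (m - (n + 1) - 1)))) q‖ ≤ ε m l)
    {X : ℝ} (hX : ∀ l ≤ 4, ∀ x : ℝ, ‖iteratedFDeriv ℝ l salmhoferCutoff x‖ ≤ X)
    (hfit_n : ∀ j ≤ 4, msPieceBaseL X σ R U (n + 1) (msLam R U d (n + 1) 3) (msLam R U d (n + 1) 4) j ≤ twoLegBar klEngGeo5 (klEngQ5 P R) U j (n + 1))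
    (hfit_m : ∀ m ∈ Ioc (n + 1) (nScales β), ∀ j ≤ 4,
      msPieceSlotL X σ ε R c U d (n + 1) (msLam R U d (n + 1) 3) (msLam R U d (n + 1) 4) m j ≤
        msBarQ klEngGeo5 (klEngQ5 P R) U (n + 1) * (R.Gfr j * uPow j U * (4 : ℝ) ^ (((j : ℤ) - 2) * m))) :
    TwoLegSizesMSTQ L M klEngGeo5 (klEngQ5 P R) R β U μ K (n + 1) :=
  have hR' : ∀ j, 0 ≤ R.Gfr j := hR.1.2.2
  twoLegSizesMSTQ_succ_of_pieces_mixed (L := L) (M := M) hR' hc (le_klCurveC3_div_sixteen_of_le_klEngC₃3 hR' hc3) hU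
    (le_klCurveU0_div_sixteen_of_le_klEngU₀4 hR' hUle) hβ hβc hμ hKp ha hn d
    (continuous_klLocalPart_stub hR hc hc3 hU hUle hβ hβc hμ hK L M (n + 1)) (continuous_klLocalPart_stub hR hc hc3 hU hUle hβ hβc hμ hK L M n)
    hS hσnn hσ0 hσ hεnn hε0 hε hX hfit_n hfit_m

/-- **(B) `TwoLegSizesMSTQ … (nScales β + 1)` UNDER THE STUB'S BINDERS** from `twoLegSizesMSTQ_top_of_frameOK` (one symbol, sizes `σ l`, l ≤ 4). -/
theorem twoLegSizesMSTQ_top_stub {P : SplitConsts} {R : RenConsts} {c : ℝ} (hR : R.WF2) (hc : 0 < c) (hc3 : c ≤ klEngC₃3 P R) {μ : ℝ}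
    (hμ : μ ∈ klWindowC) {U : ℝ} (hU : 0 < U) (hUle : U ≤ klEngU₀4 P R c) {β : ℝ} (hβ : klBetaMin ≤ β) (hβc : β ≤ Real.exp (c / U ^ 2))
    {K : TrigPolyC4v} (hK : FrameOK R U (nScales β) μ K)
    {S : TrigPolyC4v}
    (hS : ∀ θ, klLocalPart L M β U μ K (nScales β + 1) θ - klLocalPart L M β U μ K (nScales β) θ = S.eval (klFermiPoint μ K θ))
    {σ : ℕ → ℝ} (hσnn : ∀ l, 0 ≤ σ l) (hσ0 : ∀ q : Momentum, |evalM S q| ≤ σ 0)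
    (hσ : ∀ l, 1 ≤ l → l ≤ 4 → ∀ q : Momentum, ‖iteratedFDeriv ℝ l (evalM S) q‖ ≤ σ l)
    {X : ℝ} (hX : ∀ l ≤ 4, ∀ x : ℝ, ‖iteratedFDeriv ℝ l salmhoferCutoff x‖ ≤ X)
    (hfit : ∀ j ≤ 4, msPieceTop X σ R U (nScales β) j ≤ twoLegBar klEngGeo5 (klEngQ5 P R) U j (nScales β + 1)) :
    TwoLegSizesMSTQ L M klEngGeo5 (klEngQ5 P R) R β U μ K (nScales β + 1) :=
  have hR' : ∀ j, 0 ≤ R.Gfr j := hR.1.2.2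
  twoLegSizesMSTQ_top_of_frameOK (L := L) (M := M) hR' hc (hc3.trans (klEngC₃3_le_klCurveC3 P hR')) hU
    ((le_klEngU₀3_of_le_klEngU₀4 hUle).trans (klEngU₀3_le_klCurveU0 P hR' c)) hβ hβc hμ hK
    (continuous_klLocalPart_stub hR hc hc3 hU hUle hβ hβc hμ hK L M (nScales β + 1))
    (continuous_klLocalPart_stub hR hc hc3 hU hUle hβ hβc hμ hK L M (nScales β)) hS hσnn hσ0 hσ hX hfit

/-! ## §3 The core-agnostic assembly: core BY NAME, multi-slot data, nested legs -/

/-- **THE ASSEMBLY DOOR AT SCALE `n + 1 ≤ nScales β`, CORE BY NAME, MULTI-SLOT SIZES OPENED**: under (e)'s literal binders, the slot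
`TwoLegStepV16 … (n+1)` from the core conjunct `hcore : TwoLegCoreTD (histV15 …) … (n+1)` (any closer of the two-leg lane), the MS data of
`twoLegSizesMSTQ_succ_of_pieces_mixed_stub`, and the two nested-leg rates (k3c4-p1's `twoLegStepV16_of_cores_of_nestedLegs`). -/
theorem twoLegStepV16_succ_of_core_of_pieces_mixed_stub (P : SplitConsts) (R : RenConsts) (c : ℝ) (hP : P.WF) (hR : R.WF2) (hc : 0 < c)
    (hc3 : c ≤ klEngC₃3 P R) (μ : ℝ) (hμ : μ ∈ klWindowC) (U : ℝ) (hU : 0 < U) (hUle : U ≤ klEngU₀4 P R c) (β : ℝ) (hβ : klBetaMin ≤ β)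
    (hβc : β ≤ Real.exp (c / U ^ 2)) (K : TrigPolyC4v) (hK : FrameOKDeg R U (nScales β) μ K) (L M : ℕ) [NeZero L] [NeZero M]
    (hL : klEngL₃ β U ≤ L) (hM : klEngM₃ β U L ≤ M) (n : ℕ) (hn : n + 1 ≤ nScales β) (hreg : IsKLRegime U c (-((n + 1 : ℕ) : ℤ)))
    (hhist : HistP klPredsV16 L M klEngGeo5 P (klEngQ5 P R) R β U μ K (n + 1))
    (hE : EngineBoundsAtV10S L M klEngGeo5 P (klEngQ5 P R) β U μ K (n + 1))
    -- (A) the core conjunct, by name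
    (hcore : TwoLegCoreTD L M (histV15 L M klEngGeo5 P (klEngQ5 P R) R β U μ) klEngGeo5 P (klEngQ5 P R) R β U μ K (n + 1))
    -- (B) the MS-SUPPLIER-SHEET data at scale `n + 1`
    {Kp : ℕ → TrigPolyC4v} (hKp : ∀ p : Fin 2 → ℝ, K.eval p = ∑ m ∈ range (nScales β + 1), (Kp m).eval p)
    (ha : ∀ m ≤ nScales β, ∀ j ≤ 4, ∀ q : Momentum, ‖iteratedFDeriv ℝ j (evalM (Kp m)) q‖ ≤ pieceSize R U m j)
    (d : ℕ)
    {S : ℕ → TrigPolyC4v}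
    (hS : ∀ θ, klLocalPart L M β U μ K (n + 1) θ - klLocalPart L M β U μ K n θ =
      (S (nScales β - (n + 1))).eval (klFermiPoint μ K θ))
    {σ : ℕ → ℕ → ℝ} (hσnn : ∀ k l, 0 ≤ σ k l)
    (hσ0 : ∀ k ≤ nScales β - (n + 1), ∀ q : Momentum, |evalM (S k) q| ≤ σ k 0)
    (hσ : ∀ k ≤ nScales β - (n + 1), ∀ l, 1 ≤ l → l ≤ 5 → ∀ q : Momentum, ‖iteratedFDeriv ℝ l (evalM (S k)) q‖ ≤ σ k l)
    {ε : ℕ → ℕ → ℝ} (hεnn : ∀ m l, 0 ≤ ε m l)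
    (hε0 : ∀ m ∈ Ioc (n + 1) (nScales β), ∀ q : Momentum, |evalM (fsub (S (m - (n + 1))) (S (m - (n + 1) - 1))) q| ≤ ε m 0)
    (hε : ∀ m ∈ Ioc (n + 1) (nScales β), ∀ l, 1 ≤ l → l ≤ 4 → ∀ q : Momentum,
      ‖iteratedFDeriv ℝ l (evalM (fsub (S (m - (n + 1))) (S (m - (n + 1) - 1)))) q‖ ≤ ε m l)
    {X : ℝ} (hX : ∀ l ≤ 4, ∀ x : ℝ, ‖iteratedFDeriv ℝ l salmhoferCutoff x‖ ≤ X)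
    (hfit_n : ∀ j ≤ 4, msPieceBaseL X σ R U (n + 1) (msLam R U d (n + 1) 3) (msLam R U d (n + 1) 4) j ≤ twoLegBar klEngGeo5 (klEngQ5 P R) U j (n + 1))
    (hfit_m : ∀ m ∈ Ioc (n + 1) (nScales β), ∀ j ≤ 4,
      msPieceSlotL X σ ε R c U d (n + 1) (msLam R U d (n + 1) 3) (msLam R U d (n + 1) 4) m j ≤
        msBarQ klEngGeo5 (klEngQ5 P R) U (n + 1) * (R.Gfr j * uPow j U * (4 : ℝ) ^ (((j : ℤ) - 2) * m)))
    -- (C) the two nested-leg rates at scale `n + 1`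
    (hcut : ∀ (Mq : ℕ → ℕ) (L₁ M₁ M₂ : ℕ) [NeZero L₁] [NeZero M₁] [NeZero M₂], L ≤ L₁ → (klEngQ5 P R).M0 β L₁ ≤ M₁ → Mq L₁ ≤ M₁ → M₁ ≤ M₂ →
      (∀ j < n + 1, histV15 L₁ M₁ klEngGeo5 P (klEngQ5 P R) R β U μ K j ∧
        TwoLegCoreTD L₁ M₁ (histV15 L₁ M₁ klEngGeo5 P (klEngQ5 P R) R β U μ) klEngGeo5 P (klEngQ5 P R) R β U μ K j ∧
          TwoLegSizesMSTQ L₁ M₁ klEngGeo5 (klEngQ5 P R) R β U μ K j) →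
      (∀ j < n + 1, histV15 L₁ M₂ klEngGeo5 P (klEngQ5 P R) R β U μ K j ∧
        TwoLegCoreTD L₁ M₂ (histV15 L₁ M₂ klEngGeo5 P (klEngQ5 P R) R β U μ) klEngGeo5 P (klEngQ5 P R) R β U μ K j ∧
          TwoLegSizesMSTQ L₁ M₂ klEngGeo5 (klEngQ5 P R) R β U μ K j) →
        ∀ θ : ℝ, |klLocalPart L₁ M₁ β U μ K (n + 1) θ - klLocalPart L₁ M₂ β U μ K (n + 1) θ| ≤ (klEngQ5 P R).CL β (n + 1) / 4 / L₁)
    (hsp : ∀ (Mq : ℕ → ℕ) (L₁ L₂ M₂ : ℕ) [NeZero L₁] [NeZero L₂] [NeZero M₂], L ≤ L₁ → L₁ ∣ L₂ → (klEngQ5 P R).M0 β L₁ ≤ M₂ → Mq L₁ ≤ M₂ →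
      (klEngQ5 P R).M0 β L₂ ≤ M₂ → Mq L₂ ≤ M₂ →
      (∀ j < n + 1, histV15 L₁ M₂ klEngGeo5 P (klEngQ5 P R) R β U μ K j ∧
        TwoLegCoreTD L₁ M₂ (histV15 L₁ M₂ klEngGeo5 P (klEngQ5 P R) R β U μ) klEngGeo5 P (klEngQ5 P R) R β U μ K j ∧
          TwoLegSizesMSTQ L₁ M₂ klEngGeo5 (klEngQ5 P R) R β U μ K j) →
      (∀ j < n + 1, histV15 L₂ M₂ klEngGeo5 P (klEngQ5 P R) R β U μ K j ∧
        TwoLegCoreTD L₂ M₂ (histV15 L₂ M₂ klEngGeo5 P (klEngQ5 P R) R β U μ) klEngGeo5 P (klEngQ5 P R) R β U μ K j ∧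
          TwoLegSizesMSTQ L₂ M₂ klEngGeo5 (klEngQ5 P R) R β U μ K j) →
        ∀ θ : ℝ, |klLocalPart L₁ M₂ β U μ K (n + 1) θ - klLocalPart L₂ M₂ β U μ K (n + 1) θ| ≤ (klEngQ5 P R).CL β (n + 1) / 4 / L₁) :
    TwoLegStepV16 L M klEngGeo5 P (klEngQ5 P R) R β U μ K (n + 1) := by
  have _ := hP; have _ := hL; have _ := hM; have _ := hreg; have _ := hhist; have _ := hE
  exact twoLegStepV16_of_namedCores_stub hcore
    (twoLegSizesMSTQ_succ_of_pieces_mixed_stub (L := L) (M := M) hR hc hc3 hμ hU hUle hβ hβc hK.1 hn hKp ha d hS hσnn hσ0 hσ hεnn hε0 hε hX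
      hfit_n hfit_m) hcut hsp

/-- **THE ASSEMBLY DOOR AT THE TOP SCALE `nScales β + 1`, CORE BY NAME, MULTI-SLOT SIZES OPENED** (one symbol; `twoLegSizesMSTQ_top_stub`). -/
theorem twoLegStepV16_top_of_core_stub (P : SplitConsts) (R : RenConsts) (c : ℝ) (hP : P.WF) (hR : R.WF2) (hc : 0 < c)
    (hc3 : c ≤ klEngC₃3 P R) (μ : ℝ) (hμ : μ ∈ klWindowC) (U : ℝ) (hU : 0 < U) (hUle : U ≤ klEngU₀4 P R c) (β : ℝ) (hβ : klBetaMin ≤ β)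
    (hβc : β ≤ Real.exp (c / U ^ 2)) (K : TrigPolyC4v) (hK : FrameOKDeg R U (nScales β) μ K) (L M : ℕ) [NeZero L] [NeZero M]
    (hL : klEngL₃ β U ≤ L) (hM : klEngM₃ β U L ≤ M) (hreg : IsKLRegime U c (-((nScales β + 1 : ℕ) : ℤ)))
    (hhist : HistP klPredsV16 L M klEngGeo5 P (klEngQ5 P R) R β U μ K (nScales β + 1))
    (hE : EngineBoundsAtV10S L M klEngGeo5 P (klEngQ5 P R) β U μ K (nScales β + 1))
    -- (A) the core conjunct, by name
    (hcore : TwoLegCoreTD L M (histV15 L M klEngGeo5 P (klEngQ5 P R) R β U μ) klEngGeo5 P (klEngQ5 P R) R β U μ K (nScales β + 1))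
    -- (B) the MS data at the top scale: one symbol
    {S : TrigPolyC4v}
    (hS : ∀ θ, klLocalPart L M β U μ K (nScales β + 1) θ - klLocalPart L M β U μ K (nScales β) θ = S.eval (klFermiPoint μ K θ))
    {σ : ℕ → ℝ} (hσnn : ∀ l, 0 ≤ σ l) (hσ0 : ∀ q : Momentum, |evalM S q| ≤ σ 0)
    (hσ : ∀ l, 1 ≤ l → l ≤ 4 → ∀ q : Momentum, ‖iteratedFDeriv ℝ l (evalM S) q‖ ≤ σ l)
    {X : ℝ} (hX : ∀ l ≤ 4, ∀ x : ℝ, ‖iteratedFDeriv ℝ l salmhoferCutoff x‖ ≤ X)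
    (hfit : ∀ j ≤ 4, msPieceTop X σ R U (nScales β) j ≤ twoLegBar klEngGeo5 (klEngQ5 P R) U j (nScales β + 1))
    -- (C) the two nested-leg rates at the top scale
    (hcut : ∀ (Mq : ℕ → ℕ) (L₁ M₁ M₂ : ℕ) [NeZero L₁] [NeZero M₁] [NeZero M₂], L ≤ L₁ → (klEngQ5 P R).M0 β L₁ ≤ M₁ → Mq L₁ ≤ M₁ → M₁ ≤ M₂ →
      (∀ j < nScales β + 1, histV15 L₁ M₁ klEngGeo5 P (klEngQ5 P R) R β U μ K j ∧
        TwoLegCoreTD L₁ M₁ (histV15 L₁ M₁ klEngGeo5 P (klEngQ5 P R) R β U μ) klEngGeo5 P (klEngQ5 P R) R β U μ K j ∧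
          TwoLegSizesMSTQ L₁ M₁ klEngGeo5 (klEngQ5 P R) R β U μ K j) →
      (∀ j < nScales β + 1, histV15 L₁ M₂ klEngGeo5 P (klEngQ5 P R) R β U μ K j ∧
        TwoLegCoreTD L₁ M₂ (histV15 L₁ M₂ klEngGeo5 P (klEngQ5 P R) R β U μ) klEngGeo5 P (klEngQ5 P R) R β U μ K j ∧
          TwoLegSizesMSTQ L₁ M₂ klEngGeo5 (klEngQ5 P R) R β U μ K j) →
        ∀ θ : ℝ, |klLocalPart L₁ M₁ β U μ K (nScales β + 1) θ - klLocalPart L₁ M₂ β U μ K (nScales β + 1) θ| ≤ (klEngQ5 P R).CL β (nScales β + 1) / 4 / L₁)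
    (hsp : ∀ (Mq : ℕ → ℕ) (L₁ L₂ M₂ : ℕ) [NeZero L₁] [NeZero L₂] [NeZero M₂], L ≤ L₁ → L₁ ∣ L₂ → (klEngQ5 P R).M0 β L₁ ≤ M₂ → Mq L₁ ≤ M₂ →
      (klEngQ5 P R).M0 β L₂ ≤ M₂ → Mq L₂ ≤ M₂ →
      (∀ j < nScales β + 1, histV15 L₁ M₂ klEngGeo5 P (klEngQ5 P R) R β U μ K j ∧
        TwoLegCoreTD L₁ M₂ (histV15 L₁ M₂ klEngGeo5 P (klEngQ5 P R) R β U μ) klEngGeo5 P (klEngQ5 P R) R β U μ K j ∧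
          TwoLegSizesMSTQ L₁ M₂ klEngGeo5 (klEngQ5 P R) R β U μ K j) →
      (∀ j < nScales β + 1, histV15 L₂ M₂ klEngGeo5 P (klEngQ5 P R) R β U μ K j ∧
        TwoLegCoreTD L₂ M₂ (histV15 L₂ M₂ klEngGeo5 P (klEngQ5 P R) R β U μ) klEngGeo5 P (klEngQ5 P R) R β U μ K j ∧
          TwoLegSizesMSTQ L₂ M₂ klEngGeo5 (klEngQ5 P R) R β U μ K j) →
        ∀ θ : ℝ, |klLocalPart L₁ M₂ β U μ K (nScales β + 1) θ - klLocalPart L₂ M₂ β U μ K (nScales β + 1) θ| ≤ (klEngQ5 P R).CL β (nScales β + 1) / 4 / L₁) :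
    TwoLegStepV16 L M klEngGeo5 P (klEngQ5 P R) R β U μ K (nScales β + 1) := by
  have _ := hP; have _ := hL; have _ := hM; have _ := hreg; have _ := hhist; have _ := hE
  exact twoLegStepV16_of_namedCores_stub hcore
    (twoLegSizesMSTQ_top_stub (L := L) (M := M) hR hc hc3 hμ hU hUle hβ hβc hK.1 hS hσnn hσ0 hσ hX hfit) hcut hsp

end Summit.HubbardSuperconductivity.HubbardSuperconductivity.Theorems.EngineV8

end
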